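import Summits.BirchSwinnertonDyer.BirchSwinnertonDyer.Theorems.ByReductionTypeAtTwoMultTowerNS2LocalLayerIndex
import Literature.NumberTheory.GaloisRepresentations.ArtinRestriction
import HarnessLib

/-!
# Route `ByReductionTypeAtTwo`, crux `MultUpperHalfAtTwo` (item stmt-BirchSwinnertonDyer-19922), TOWER road, the
# «ONE BIT AT A NON-SPLIT 2» rows: KERNEL BRICK 9 — the local layer FIELDS `(ℚ_n)_w = K̄_v^{H_n}` of the cyclotomic
# `ℤ_p`-tower at `v ∣ p` are finite of degree `p^n` over `ℚ_v`, nested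

HONEST FRAMING (cell `bsd-2adic`, run/shared/lean/pub/bsd-2adic/, seat `bsd-2adic-tower-1` GEN 8, HUMAN RULINGS
D-0036 / D-0054 / D-0074): TOOL theorems only (no definition, no named fact, no `sorry`); closes nothing by itself;
nothing booked; BSD is not proved by any of this. Second brick of module M5 («the local tower at 2») of the KERNELISATION of
the displayed MEMO binder `MultTowerNS2.localTowerKerTwoTorsion_le_two_nonsplitTwo_of_tateUnit` (scope
HOME/tower/SCOPE-hNS2one-kernel-GEN8.md): the fixed fields `F_n := K̄_v^{H_n}`,
`H_n = localSubgroup (κ.layerSubgroup n) ℚ_v` (BRICK 8: index `p^n`, open), as `IntermediateField ℚ_v K̄_v` — the local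
layers `ℚ_{p,n}` (for `p = 2`: `ℚ₂(ζ_{2^{n+2}} + ζ⁻¹)`) on which steps S4–S6 of the scope run the class field axiom
(`cyclicNormIndexEq_holds` is stated for such intermediate fields). Krull correspondence for open subgroups:
tree `GaloisRepresentations.finrank_fixedField_of_isOpen` / `finiteDimensional_fixedField_of_isOpen` (`ArtinRestriction.lean`).

* `isOpen_localSubgroup` — `localSubgroup H E` is open for `H` open (preimage under the continuous restriction);
* `finiteDimensional_fixedField_localSubgroup_layerSubgroup`, **`finrank_fixedField_localSubgroup_layerSubgroup`**
  (`= p^n`), `finrank_fixedField_localSubgroup_layerSubgroup_succ` (`[F_{n+1} : ℚ_v] = p · [F_n : ℚ_v]`),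
  `fixedField_localSubgroup_layerSubgroup_le_succ` (`F_n ≤ F_{n+1}`).

References: L. Washington, *Introduction to Cyclotomic Fields*, §13.1; J. Neukirch, *ANT* IV §1 (Krull); scope memo M5.
-/

set_option autoImplicit false
-- the Theorems namespace of this sub repeats the summit name by design (D-0017 nested layout: Summit.<S>.<Sub>)
set_option linter.dupNamespace false

noncomputable section

namespace Summit.BirchSwinnertonDyer.BirchSwinnertonDyer.Theorems.MultTowerNS2

open NumberField IsDedekindDomain Field Literature.NumberTheory.EllipticCurves
  Literature.NumberTheory.GaloisRepresentations

universe u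

/-- `localSubgroup H E = res⁻¹(H)` is open in `Γ_E` when `H` is open in `Γ_K` (the restriction `resGal E` is
continuous). [folklore] -/
theorem isOpen_localSubgroup {K : Type u} [Field K] (H : Subgroup (absoluteGaloisGroup K))
    (hH : IsOpen (H : Set (absoluteGaloisGroup K))) (E : Type u) [Field E] [Algebra K E] :
    IsOpen (localSubgroup H E : Set (absoluteGaloisGroup E)) :=
  hH.preimage (resGal (K := K) E).continuous_toFun

variable {p : ℕ} [Fact p.Prime] {κ : ZpExtension ℚ p}

/-- The local layer field `F_n = K̄_v^{H_n}` is a finite extension of `ℚ_v`. [cite: Washington1997, §13.1] -/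
theorem finiteDimensional_fixedField_localSubgroup_layerSubgroup (v : HeightOneSpectrum (𝓞 ℚ)) (n : ℕ) :
    FiniteDimensional (v.adicCompletion ℚ)
      (IntermediateField.fixedField (localSubgroup (κ.layerSubgroup n) (v.adicCompletion ℚ)) :
        IntermediateField (v.adicCompletion ℚ) (AlgebraicClosure (v.adicCompletion ℚ))) := by
  have hopen := isOpen_localSubgroup (κ.layerSubgroup n) (κ.isOpen_layerSubgroup n) (v.adicCompletion ℚ)
  haveI : CharZero (v.adicCompletion ℚ) :=
    charZero_of_injective_algebraMap (algebraMap ℚ (v.adicCompletion ℚ)).injective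
  exact finiteDimensional_fixedField_of_isOpen _ hopen

/-- **`[F_n : ℚ_v] = p^n`**: the fixed field of the `n`-th local layer subgroup of the cyclotomic `ℤ_p`-tower at
`v ∣ p` has degree `p^n` over `ℚ_v` — the local degree equals the global one, `p` is totally ramified
(BRICK 8 `index_localSubgroup_layerSubgroup` + Krull). [cite: Washington1997, §13.1] -/
theorem finrank_fixedField_localSubgroup_layerSubgroup (hκ : κ.IsCyclotomic) (v : HeightOneSpectrum (𝓞 ℚ))
    (hv : (p : 𝓞 ℚ) ∈ v.asIdeal) (n : ℕ) :
    Module.finrank (v.adicCompletion ℚ)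
      (IntermediateField.fixedField (localSubgroup (κ.layerSubgroup n) (v.adicCompletion ℚ)) :
        IntermediateField (v.adicCompletion ℚ) (AlgebraicClosure (v.adicCompletion ℚ))) = p ^ n := by
  have hopen := isOpen_localSubgroup (κ.layerSubgroup n) (κ.isOpen_layerSubgroup n) (v.adicCompletion ℚ)
  have hidx := index_localSubgroup_layerSubgroup hκ v hv n
  haveI : CharZero (v.adicCompletion ℚ) :=
    charZero_of_injective_algebraMap (algebraMap ℚ (v.adicCompletion ℚ)).injective
  have h := finrank_fixedField_of_isOpen _ hopen
  rw [hidx] at h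
  exact h

/-- **`[F_{n+1} : ℚ_v] = p · [F_n : ℚ_v]`** (so `[F_{n+1} : F_n] = p`; for `p = 2` the local layers are successive
QUADRATIC extensions). [cite: Washington1997, §13.1] -/
theorem finrank_fixedField_localSubgroup_layerSubgroup_succ (hκ : κ.IsCyclotomic) (v : HeightOneSpectrum (𝓞 ℚ))
    (hv : (p : 𝓞 ℚ) ∈ v.asIdeal) (n : ℕ) :
    Module.finrank (v.adicCompletion ℚ)
      (IntermediateField.fixedField (localSubgroup (κ.layerSubgroup (n + 1)) (v.adicCompletion ℚ)) :
        IntermediateField (v.adicCompletion ℚ) (AlgebraicClosure (v.adicCompletion ℚ))) =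
      p * Module.finrank (v.adicCompletion ℚ)
        (IntermediateField.fixedField (localSubgroup (κ.layerSubgroup n) (v.adicCompletion ℚ)) :
          IntermediateField (v.adicCompletion ℚ) (AlgebraicClosure (v.adicCompletion ℚ))) := by
  rw [finrank_fixedField_localSubgroup_layerSubgroup hκ v hv, finrank_fixedField_localSubgroup_layerSubgroup hκ v hv,
    pow_succ, mul_comm]

/-- **`F_n ≤ F_{n+1}`**: the local layer fields increase (`H_{n+1} ≤ H_n`). [cite: Washington1997, §13.1] -/
theorem fixedField_localSubgroup_layerSubgroup_le_succ (v : HeightOneSpectrum (𝓞 ℚ)) (n : ℕ) :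
    (IntermediateField.fixedField (localSubgroup (κ.layerSubgroup n) (v.adicCompletion ℚ)) :
        IntermediateField (v.adicCompletion ℚ) (AlgebraicClosure (v.adicCompletion ℚ))) ≤
      IntermediateField.fixedField (localSubgroup (κ.layerSubgroup (n + 1)) (v.adicCompletion ℚ)) :=
  IntermediateField.fixedField_le (localSubgroup_layerSubgroup_succ_le (κ := κ) v n)

end Summit.BirchSwinnertonDyer.BirchSwinnertonDyer.Theorems.MultTowerNS2

end
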